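/-
Copyright (c) 2026. All rights reserved.
Released under Apache 2.0 license as described in the file LICENSE.
Authors: abc-iut cell, campaign-S prover seat abc-iut-S6 (wave 2).
-/
import Literature.IUT.LogVolume.TensorPacketLogTransport
import HarnessLib

/-!
# [IUTchIV] Proposition 1.2 (ii), (iii): differents and logarithms on tensor packets — PROOFS

Mochizuki, *Inter-universal Teichmüller theory IV*, RIMS manuscript (Apr. 2020), §1, Prop. 1.2
(ii)–(iii), statements kurims pp. 10–11, proof p. 11.  PROOF-ONLY companion of abc-iut-S1's
`TensorPacketRing.lean` (statements `Prop12ii`, `Prop12ii'`, `Prop12iii`, `Prop12iii'`): each is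
proved here as an implication from the typed statement `Prop11 p k` of Prop. 1.1 (proved separately by
abc-iut-S5; the unconditional corollaries are one-liners once `prop11_holds` lands), exactly along the
printed proof (p. 11):

  "`p^{d_I+a_I}·(R_I)^∼ ⊆ ⊗_{i∈I} p^{a_i}·R_i (⊆ R_I)` [first inclusion of Prop. 1.1] and hence
  `p^λ·(R_I)^∼ ⊆ p^{λ−d_I−a_I}·p^{d_I+a_I}·(R_I)^∼ ⊆ p^{⌊λ−d_I−a_I⌋}·p^{d_I+a_I}·(R_I)^∼ ⊆
  p^{⌊λ−d_I−a_I⌋}·log_p(R_I^×) ⊆ p^{⌊λ−d_I−a_I⌋−b_I}·(R_I)^∼` — where, in the passage to the third and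
  fourth inclusions …, we apply assertion (i) … Thus, assertion (ii) follows immediately from the fact
  that `φ` induces an automorphism of the submodule `log_p(R_I^×)`. Assertion (iii) follows from
  assertion (ii), together with … `a_I = −b_I`, which implies `⌊λ−d_I−a_I⌋−b_I ≥ λ−d_I−a_I−1−b_I ≥
  λ−d_I−1`."

Inputs (`TensorPacketLogTransport.lean`, `TensorPacketLemmas.lean`): Prop. 1.2 (i) transported to
packets, Prop. 1.1 in the all-`δ` form, and the fractional-`p`-power bookkeeping
(`exists_eq_ppow_mul_of_prod_norm_le`, `smul_normalizedPacket_subset_of_prod_norm_le`) for the one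
step the text leaves implicit (`p^{μ}·(R_I)^∼ ⊆ p^{⌊μ⌋}·(R_I)^∼`, which in print rests on `(R_I)^∼`
being a product of integer rings; here proved inside `V`).  Part (iv) (which needs `d_i = 0` for
`e_i = 1`) is in a sibling file.  No definitions, no named facts, no `sorry`.
-/

noncomputable section

open Metric Set IsLocalRing
open scoped Pointwise TensorProduct NormedField

namespace Literature.IUT.LogVolume

variable (p : ℕ) [Fact p.Prime]
variable {I : Type} [Fintype I] [DecidableEq I]
variable (k : I → Type) [∀ i, NontriviallyNormedField (k i)] [∀ i, NormedAlgebra ℚ_[p] (k i)]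
  [∀ i, IsUltrametricDist (k i)] [∀ i, ProperSpace (k i)]

/-! ## The chain of inclusions of p. 11 -/

/-- **The third/fourth-to-last links of the chain on p. 11**: for nonzero `c_i` with
`Σ ord(c_i) ≥ n + d_I + a_I` (`n ∈ ℤ`), `(⊗c_i)·(R_I)^∼ ⊆ p^n·log_p(R_I^×)`.  Proof as printed:
`⊗c_i = (⊗ c_i δ_i⁻¹ α_i⁻¹)·(⊗δ_i)·(⊗α_i)` with `ord(α_i) = a_i`; the first factor is `p^n·y`,
`y ∈ (R_I)^∼` (`exists_eq_ppow_mul_of_prod_norm_le`); `(⊗δ_i)·(R_I)^∼ ⊆ R_I` (Prop. 1.1);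
`(⊗α_i)·R_I ⊆ log_p(R_I^×)` (Prop. 1.2 (i)). [claim: Mochizuki2012, status: disputed] -/
theorem purePacket_smul_normalizedPacket_subset_ppow_smul_logPacket (h11 : Prop11 p k)
    (hI : 2 ≤ Fintype.card I) {c : Π i, k i} (hc : ∀ i, c i ≠ 0) {n : ℤ}
    (hn : ∏ i, ‖c i‖ ≤ (p : ℝ) ^ (-((n : ℝ) + dSum p k + aSum p k))) :
    purePacket p k c • (normalizedPacket p k : Set (PacketAlgebra p k)) ⊆
      ppow p k n • (logPacket p k : Set (PacketAlgebra p k)) := by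
  have hne : Nonempty I := Fintype.card_pos_iff.mp (by omega)
  have hp0 : (0 : ℝ) < p := by exact_mod_cast (Fact.out : p.Prime).pos
  choose δ hδ using fun i ↦ exists_different_eq_span p (k i)
  have hδ0 : ∀ i, (δ i : k i) ≠ 0 := fun i ↦ (norm_generator_different p (k i) (hδ i)).1
  have hδn : ∀ i, ‖(δ i : k i)‖ = (p : ℝ) ^ (-differentOrd p (k i)) := fun i ↦
    (norm_generator_different p (k i) (hδ i)).2
  choose α hα0 hαn using fun i ↦ exists_norm_eq_rpow_neg_logRadiusA p (k i)
  have hdα0 : ∀ i, (δ i : k i) * α i ≠ 0 := fun i ↦ mul_ne_zero (hδ0 i) (hα0 i)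
  -- the quotient tensor `⊗ c_i/(δ_i α_i)` has `∏ ‖·‖ ≤ p^{−n}`
  have hG : ∏ i, ‖c i / ((δ i : k i) * α i)‖ ≤ (p : ℝ) ^ (-(n : ℝ)) := by
    have e1 : ∏ i, ‖c i / ((δ i : k i) * α i)‖ =
        (∏ i, ‖c i‖) / ((p : ℝ) ^ (-dSum p k) * (p : ℝ) ^ (-aSum p k)) := by
      simp_rw [norm_div, norm_mul, Finset.prod_div_distrib, Finset.prod_mul_distrib]
      rw [prod_norm_eq_rpow_neg_sum p k hδn, prod_norm_eq_rpow_neg_sum p k hαn]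
      rfl
    rw [e1, div_le_iff₀ (by positivity)]
    calc ∏ i, ‖c i‖ ≤ (p : ℝ) ^ (-((n : ℝ) + dSum p k + aSum p k)) := hn
      _ = (p : ℝ) ^ (-(n : ℝ)) * ((p : ℝ) ^ (-dSum p k) * (p : ℝ) ^ (-aSum p k)) := by
        rw [← Real.rpow_add hp0, ← Real.rpow_add hp0]
        congr 1
        ring
  obtain ⟨y, hy, hGy⟩ := exists_eq_ppow_mul_of_prod_norm_le p k (fun i ↦ div_ne_zero (hc i) (hdα0 i)) hG
  have hc_eq : purePacket p k c =
      ppow p k n * y * purePacket p k (fun i ↦ (δ i : k i)) * purePacket p k α := by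
    rw [← hGy, purePacket_mul, purePacket_mul]
    congr 1
    funext i
    simp only [Pi.mul_apply]
    rw [mul_assoc, div_mul_cancel₀ _ (hdα0 i)]
  rintro _ ⟨x, hx, rfl⟩
  have hyx : y * x ∈ normalizedPacket p k := mul_mem hy hx
  have hr := purePacket_generators_mul_mem_integerPacket p k h11 hI hδ hyx
  have hw := purePacket_mul_mem_logPacket p k (fun i ↦ (hαn i).le) hr
  refine ⟨_, hw, ?_⟩
  simp only [smul_eq_mul, hc_eq]
  ring

/-! ## [IUTchIV] Proposition 1.2 (ii) -/

/-- **[IUTchIV] Prop. 1.2 (ii) from Prop. 1.1** (p. 10; proof p. 11): for `λ = m/e_i`, `ord(g) = λ`,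
`n = ⌊λ − d_I − a_I⌋` and `h` realising `p^{−b_I}`,
`φ(p^λ·(R_I)^∼) ⊆ p^n·log_p(R_I^×) ⊆ p^{n}·p^{−b_I}·(R_I)^∼`. [claim: Mochizuki2012, status: disputed] -/
theorem prop12ii_of_prop11 (h11 : Prop11 p k) : Prop12ii p k := by
  intro hI φ hφ i m g hg h hh
  have hp0 : (0 : ℝ) < p := by exact_mod_cast (Fact.out : p.Prime).pos
  have hp1 : (1 : ℝ) < p := by exact_mod_cast (Fact.out : p.Prime).one_lt
  set n : ℤ := ⌊(m : ℝ) / absRamificationIdx p (k i) - dSum p k - aSum p k⌋ with hn_def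
  have hg0 : g ≠ 0 := norm_pos_iff.mp (by rw [hg]; positivity)
  refine ⟨?_, ppow_smul_logPacket_subset p k hh n⟩
  have hsub : iota p k i g • (normalizedPacket p k : Set (PacketAlgebra p k)) ⊆
      ppow p k n • (logPacket p k : Set (PacketAlgebra p k)) := by
    rw [iota_eq_purePacket]
    refine purePacket_smul_normalizedPacket_subset_ppow_smul_logPacket p k h11 hI
      (fun j ↦ ?_) ?_
    · by_cases hj : j = i
      · subst hj; rwa [Pi.mulSingle_eq_same]
      · rw [Pi.mulSingle_eq_of_ne hj]; exact one_ne_zero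
    · rw [Finset.prod_eq_single i (fun j _ hj ↦ by rw [Pi.mulSingle_eq_of_ne hj, norm_one])
        (fun hi ↦ absurd (Finset.mem_univ i) hi), Pi.mulSingle_eq_same, hg]
      refine Real.rpow_le_rpow_of_exponent_le hp1.le ?_
      have := Int.floor_le ((m : ℝ) / absRamificationIdx p (k i) - dSum p k - aSum p k)
      linarith
  calc (φ : PacketAlgebra p k → PacketAlgebra p k) ''
        (iota p k i g • (normalizedPacket p k : Set (PacketAlgebra p k)))
      ⊆ φ '' (ppow p k n • (logPacket p k : Set (PacketAlgebra p k))) := Set.image_mono hsub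
    _ = ppow p k n • (φ '' (logPacket p k : Set (PacketAlgebra p k))) := image_ppow_smul p k φ n _
    _ = ppow p k n • (logPacket p k : Set (PacketAlgebra p k)) := by rw [hφ]

/-- **[IUTchIV] Prop. 1.2 (ii), "In particular", from Prop. 1.1** (p. 10): with `N = ⌈d_I + a_I⌉`,
`φ((R_I)^∼) ⊆ p^{−N}·log_p(R_I^×) ⊆ p^{−N}·p^{−b_I}·(R_I)^∼` (the case `λ = 0`, `⌊−d_I−a_I⌋ = −N`).
[claim: Mochizuki2012, status: disputed] -/
theorem prop12ii'_of_prop11 (h11 : Prop11 p k) : Prop12ii' p k := by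
  intro hI φ hφ h hh
  have hp1 : (1 : ℝ) < p := by exact_mod_cast (Fact.out : p.Prime).one_lt
  set N : ℤ := ⌈dSum p k + aSum p k⌉ with hN_def
  refine ⟨?_, ppow_smul_logPacket_subset p k hh (-N)⟩
  have hsub : (normalizedPacket p k : Set (PacketAlgebra p k)) ⊆
      ppow p k (-N) • (logPacket p k : Set (PacketAlgebra p k)) := by
    have h1 := purePacket_smul_normalizedPacket_subset_ppow_smul_logPacket p k h11 hI
      (c := 1) (n := -N) (fun _ ↦ one_ne_zero) ?_
    · rwa [purePacket_one, one_smul] at h1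
    · simp only [Pi.one_apply, norm_one, Finset.prod_const_one]
      refine Real.one_le_rpow hp1.le ?_
      have := Int.le_ceil (dSum p k + aSum p k)
      push_cast
      linarith
  calc (φ : PacketAlgebra p k → PacketAlgebra p k) '' (normalizedPacket p k : Set (PacketAlgebra p k))
      ⊆ φ '' (ppow p k (-N) • (logPacket p k : Set (PacketAlgebra p k))) := Set.image_mono hsub
    _ = ppow p k (-N) • (φ '' (logPacket p k : Set (PacketAlgebra p k))) :=
        image_ppow_smul p k φ (-N) _
    _ = ppow p k (-N) • (logPacket p k : Set (PacketAlgebra p k)) := by rw [hφ]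

/-! ## [IUTchIV] Proposition 1.2 (iii) -/

/-- **[IUTchIV] Prop. 1.2 (iii) from Prop. 1.1** (p. 11): if `p > 2` and `e_i ≤ p − 2` for all `i`,
then `φ(p^λ·(R_I)^∼) ⊆ p^{λ−d_I−1}·(R_I)^∼` — from (ii) and `⌊λ−d_I−a_I⌋ − b_I ≥ λ−d_I−a_I−1−b_I =
λ−d_I−1` (`a_I = −b_I`), the comparison of the two "`p^μ`" being
`smul_normalizedPacket_subset_of_prod_norm_le`. [claim: Mochizuki2012, status: disputed] -/
theorem prop12iii_of_prop11 (h11 : Prop11 p k) : Prop12iii p k := by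
  intro hI hp he φ hφ i m g hg δ hδ
  have hne : Nonempty I := Fintype.card_pos_iff.mp (by omega)
  have hp0 : (0 : ℝ) < p := by exact_mod_cast (Fact.out : p.Prime).pos
  have hp1 : (1 : ℝ) < p := by exact_mod_cast (Fact.out : p.Prime).one_lt
  have hg0 : g ≠ 0 := norm_pos_iff.mp (by rw [hg]; positivity)
  have hδ0 : ∀ j, (δ j : k j) ≠ 0 := fun j ↦ (norm_generator_different p (k j) (hδ j)).1
  obtain ⟨h, hh⟩ := exists_realizesNegB p k
  obtain ⟨h1, h2⟩ := prop12ii_of_prop11 p k h11 hI φ hφ i m g hg h hh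
  refine (h1.trans h2).trans ?_
  rw [show iota p k i g * purePacket p k (fun j ↦ ((δ j : k j))⁻¹) * ppow p k (-1) =
      ppow p k (-1) * purePacket p k (Pi.mulSingle i g * fun j ↦ ((δ j : k j))⁻¹) by
    rw [iota_eq_purePacket, ← purePacket_mul]; ring]
  refine smul_normalizedPacket_subset_of_prod_norm_le p k (ne_zero_of_realizesNegB p k hh)
    (fun j ↦ mul_ne_zero (mulSingle_ne_zero k hg0 j) (inv_ne_zero (hδ0 j))) ?_
  have hprod : ∏ j, ‖Pi.mulSingle (M := fun j ↦ k j) i g j * ((δ j : k j))⁻¹‖ =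
      (p : ℝ) ^ (-((m : ℝ) / absRamificationIdx p (k i))) * (p : ℝ) ^ dSum p k := by
    simp_rw [norm_mul, Finset.prod_mul_distrib]
    rw [prod_norm_mulSingle k i g, hg, prod_norm_inv_generators p k hδ]
  rw [prod_norm_of_realizesNegB p k hh, bSum_eq_neg_aSum p k hp he, hprod, ← Real.rpow_add hp0,
    ← Real.rpow_add hp0, ← Real.rpow_add hp0]
  refine Real.rpow_le_rpow_of_exponent_le hp1.le ?_
  have := Int.lt_floor_add_one ((m : ℝ) / absRamificationIdx p (k i) - dSum p k - aSum p k)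
  push_cast
  linarith

/-- **[IUTchIV] Prop. 1.2 (iii), "In particular", from Prop. 1.1** (p. 11): under the same hypotheses
`φ((R_I)^∼) ⊆ p^{−d_I−1}·(R_I)^∼` (from (ii) "In particular" and `⌈d_I+a_I⌉ < d_I+a_I+1`).
[claim: Mochizuki2012, status: disputed] -/
theorem prop12iii'_of_prop11 (h11 : Prop11 p k) : Prop12iii' p k := by
  intro hI hp he φ hφ δ hδ
  have hne : Nonempty I := Fintype.card_pos_iff.mp (by omega)
  have hp0 : (0 : ℝ) < p := by exact_mod_cast (Fact.out : p.Prime).pos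
  have hp1 : (1 : ℝ) < p := by exact_mod_cast (Fact.out : p.Prime).one_lt
  have hδ0 : ∀ j, (δ j : k j) ≠ 0 := fun j ↦ (norm_generator_different p (k j) (hδ j)).1
  obtain ⟨h, hh⟩ := exists_realizesNegB p k
  obtain ⟨h1, h2⟩ := prop12ii'_of_prop11 p k h11 hI φ hφ h hh
  refine (h1.trans h2).trans ?_
  rw [show purePacket p k (fun j ↦ ((δ j : k j))⁻¹) * ppow p k (-1) =
      ppow p k (-1) * purePacket p k (fun j ↦ ((δ j : k j))⁻¹) from mul_comm _ _]
  refine smul_normalizedPacket_subset_of_prod_norm_le p k (ne_zero_of_realizesNegB p k hh)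
    (fun j ↦ inv_ne_zero (hδ0 j)) ?_
  rw [prod_norm_of_realizesNegB p k hh, bSum_eq_neg_aSum p k hp he, prod_norm_inv_generators p k hδ,
    ← Real.rpow_add hp0, ← Real.rpow_add hp0]
  refine Real.rpow_le_rpow_of_exponent_le hp1.le ?_
  have := Int.ceil_lt_add_one (dSum p k + aSum p k)
  push_cast
  linarith


end Literature.IUT.LogVolume

end
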